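import Mathlib
import HarnessLib

/-!
# Route `KLProgramme` — engine support (route (L2)): an INTEGER vector within `1/2` per coordinate of a scaled unit vector — the integer frame
# `(v⊥, v)` of the anisotropic additive weight, `v = round(R·τ)` with `R ≍ 2ⁿ` along the sector's tangent `τ`

Cell `gate-hubbard-kl`, seat hubbard-kl-k3c2-p3; gen-4 ENGINE child stmt-HubbardSuperconductivity-19855 (`stub_engine_step_norms`, propagator `α_n`;
the same vector serves the p4 lineage's multiplier size `B`).  The anisotropic `ℓ²` route (`sum_inv_additiveQuarticWeight_le`,
`slicePair_charSum_l1_le`) differences the symbol along an INTEGER direction `v ∈ ℤ² ∖ {0}` that must be tangent to the frame's Fermi curve up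
to an angle `≲ 2^{−n}` and of length `≲ 2ⁿ`; coordinatewise rounding of `R·τ` (`τ` the unit tangent, `R ≥ 1`) does it:

* `abs_round_sub_le_half` — `|round x − x| ≤ 1/2`;
* **`intRound`-free statements** about `v i := round (R * u i)`: `abs_intCast_round_sub_le` (coordinate error `≤ 1/2`),
  `round_ne_zero_of_unit` (`v ≠ 0` for `R ≥ 1`), `abs_round_le` (`|v i| ≤ R|u i| + 1/2`), `sum_abs_round_le` (`|v₀| + |v₁| ≤ 2R + 1`),
  and **`abs_apply_round_le`**: for any linear functional `ℓ` on `Fin 2 → ℝ`, `|ℓ(v)| ≤ R·|ℓ(u)| + (|ℓ e₀| + |ℓ e₁|)/2` — with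
  `ℓ = De_K(p)` and `u = τ` this is the tangential datum `τ_v ≤ R·|De_K(p)·τ| + ‖De_K‖_{1}/2` of the instance.

Everything is proved; no definitions, no named facts. [folklore]
-/

noncomputable section

namespace Summit.HubbardSuperconductivity.HubbardSuperconductivity.Theorems.TorusFourierL2

set_option linter.dupNamespace false -- summit = problem name (single-conjunct summit), D-0017

open Finset

/-- `|round x − x| ≤ 1/2`. [folklore] -/
theorem abs_round_sub_le_half (x : ℝ) : |(round x : ℝ) - x| ≤ 1 / 2 := by
  rw [abs_sub_comm]; exact abs_sub_round x

/-- Coordinate error of the rounded vector: `|v i − R u i| ≤ 1/2`, `v i = round (R u i)`. [folklore] -/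
theorem abs_intCast_round_sub_le (R : ℝ) (u : Fin 2 → ℝ) (i : Fin 2) :
    |((round (R * u i) : ℤ) : ℝ) - R * u i| ≤ 1 / 2 :=
  abs_round_sub_le_half _

/-- `|v i| ≤ R|u i| + 1/2` (`R ≥ 0`). [folklore] -/
theorem abs_round_le {R : ℝ} (hR : 0 ≤ R) (u : Fin 2 → ℝ) (i : Fin 2) :
    |((round (R * u i) : ℤ) : ℝ)| ≤ R * |u i| + 1 / 2 := by
  have h := abs_intCast_round_sub_le R u i
  have h2 : |((round (R * u i) : ℤ) : ℝ)| ≤ |R * u i| + |((round (R * u i) : ℤ) : ℝ) - R * u i| := by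
    have := abs_add_le (R * u i) (((round (R * u i) : ℤ) : ℝ) - R * u i)
    rwa [add_sub_cancel] at this
  rw [abs_mul, abs_of_nonneg hR] at h2
  linarith

/-- For a unit vector `u` (`u₀² + u₁² = 1`): `|u i| ≤ 1`. [folklore] -/
theorem abs_le_one_of_unit {u : Fin 2 → ℝ} (hu : u 0 ^ 2 + u 1 ^ 2 = 1) (i : Fin 2) : |u i| ≤ 1 := by
  have h0 : u 0 ^ 2 ≤ 1 := by nlinarith [sq_nonneg (u 1)]
  have h1 : u 1 ^ 2 ≤ 1 := by nlinarith [sq_nonneg (u 0)]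
  fin_cases i
  · change |u 0| ≤ 1
    exact (abs_le_one_iff_mul_self_le_one).2 (by nlinarith [sq_abs (u 0)])
  · change |u 1| ≤ 1
    exact (abs_le_one_iff_mul_self_le_one).2 (by nlinarith [sq_abs (u 1)])

/-- `|v₀| + |v₁| ≤ 2R + 1` for a unit vector `u` and `R ≥ 0`. [folklore] -/
theorem sum_abs_round_le {R : ℝ} (hR : 0 ≤ R) {u : Fin 2 → ℝ} (hu : u 0 ^ 2 + u 1 ^ 2 = 1) :
    |((round (R * u 0) : ℤ) : ℝ)| + |((round (R * u 1) : ℤ) : ℝ)| ≤ 2 * R + 1 := by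
  have h0 := abs_round_le hR u 0
  have h1 := abs_round_le hR u 1
  have hu0 := abs_le_one_of_unit hu 0
  have hu1 := abs_le_one_of_unit hu 1
  nlinarith

/-- **The rounded vector is nonzero** for a unit vector `u` and `R ≥ 1` (one coordinate of `u` has `|u i| ≥ 1/√2 > 1/2`, so `R|u i| > 1/2`).
[folklore] -/
theorem round_ne_zero_of_unit {R : ℝ} (hR : 1 ≤ R) {u : Fin 2 → ℝ} (hu : u 0 ^ 2 + u 1 ^ 2 = 1) :
    (fun i : Fin 2 => (round (R * u i) : ℤ)) ≠ 0 := by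
  intro h
  have h0 : (round (R * u 0) : ℤ) = 0 := by simpa using congrFun h 0
  have h1 : (round (R * u 1) : ℤ) = 0 := by simpa using congrFun h 1
  have e0 := abs_intCast_round_sub_le R u 0
  have e1 := abs_intCast_round_sub_le R u 1
  rw [h0, Int.cast_zero, zero_sub, abs_neg] at e0
  rw [h1, Int.cast_zero, zero_sub, abs_neg] at e1
  have s0 : (R * u 0) ^ 2 ≤ 1 / 4 := by
    have := sq_abs (R * u 0) ▸ pow_le_pow_left₀ (abs_nonneg _) e0 2; nlinarith
  have s1 : (R * u 1) ^ 2 ≤ 1 / 4 := by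
    have := sq_abs (R * u 1) ▸ pow_le_pow_left₀ (abs_nonneg _) e1 2; nlinarith
  have : R ^ 2 * (u 0 ^ 2 + u 1 ^ 2) ≤ 1 / 2 := by nlinarith
  rw [hu, mul_one] at this
  nlinarith

/-- **A linear functional on the rounded vector**: `|ℓ(v)| ≤ R·|ℓ(u)| + (|ℓ e₀| + |ℓ e₁|)/2` (`e₀, e₁` the coordinate vectors) — the integer
direction inherits the smallness of `ℓ(u)` up to half the `ℓ¹` size of `ℓ`. [folklore] -/
theorem abs_apply_round_le (ℓ : (Fin 2 → ℝ) →ₗ[ℝ] ℝ) {R : ℝ} (hR : 0 ≤ R) (u : Fin 2 → ℝ) :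
    |ℓ (fun i => ((round (R * u i) : ℤ) : ℝ))| ≤
      R * |ℓ u| + (|ℓ (Pi.single 0 1)| + |ℓ (Pi.single 1 1)|) / 2 := by
  set v : Fin 2 → ℝ := fun i => ((round (R * u i) : ℤ) : ℝ) with hv
  -- `v = R•u + d` with `|d i| ≤ 1/2`
  set d : Fin 2 → ℝ := fun i => v i - R * u i with hd
  have hdec : v = R • u + d := by
    funext i; simp [hd, hv]
  have hdi : ∀ i, |d i| ≤ 1 / 2 := fun i => by
    simp only [hd, hv]; exact abs_intCast_round_sub_le R u i
  have hdexp : d = d 0 • (Pi.single 0 (1 : ℝ) : Fin 2 → ℝ) + d 1 • (Pi.single 1 (1 : ℝ) : Fin 2 → ℝ) := by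
    funext i; fin_cases i <;> simp
  have hℓd : |ℓ d| ≤ (|ℓ (Pi.single 0 1)| + |ℓ (Pi.single 1 1)|) / 2 := by
    rw [hdexp, map_add, map_smul, map_smul, smul_eq_mul, smul_eq_mul]
    refine (abs_add_le _ _).trans ?_
    rw [abs_mul, abs_mul]
    have h0 := hdi 0
    have h1 := hdi 1
    nlinarith [abs_nonneg (ℓ (Pi.single 0 1)), abs_nonneg (ℓ (Pi.single 1 1)), abs_nonneg (d 0), abs_nonneg (d 1)]
  rw [hdec, map_add, map_smul, smul_eq_mul]
  refine (abs_add_le _ _).trans ?_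
  rw [abs_mul, abs_of_nonneg hR]
  linarith

end Summit.HubbardSuperconductivity.HubbardSuperconductivity.Theorems.TorusFourierL2

end
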